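import Summits.QuantumFields.BalabanUV.Beta.EriceRemainderEnclosureHistoryAutonomyThreshold
import Literature.Analysis.Convex.SchauderFixedPoint
import Mathlib.Topology.ContinuousMap.Bounded.Normed

/-!
# EriceRemainderEnclosureHistoryAutonomyExistence — (E39) EXISTENCE WITHOUT SMALLNESS: the flow with memory of a functional with ZEROTH
# MOMENT `M` (any size) and floor `b > 0` on ]0,γ] HAS a box solution from EVERY pin `gIR ∈ ]0,γ]` — Schauder's fixed point theorem for
# node U2's solution map on the asymptotic-freedom cube `∏_m [(1∕gIR² + m·B̄)^{−1∕2}, (1∕gIR² + m·b)^{−1∕2}]`, which the floor makes COMPACT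
# in the supremum norm (widths `≤ (m·b)^{−1∕2} → 0`); so (E38)'s `3√3` is a UNIQUENESS threshold only: `M·γ ≤ 3√3·b` ⟹ EXACTLY one box
# solution (`∃!` under the CLOSED condition, improving (E38b)'s `<`), `M·γ > 3√3·b` ⟹ AT LEAST one, and for some functionals two ((E38c))

Cell `pub-balaban`, β-function sub-cell, BINDER row D4 «RemainderConst leaves for Bałaban's split» (`HOME/BINDER-OWNERS.md`; owner
lineage `b2b-balaban-beta-an4`; this file by co-owner #2 lineage `b2b-balaban-beta-d4-p2`, generation 40), β-FLOW TEAM duty (1),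
FREEZE (0) honoured (def-free: the cube, the clamp and the solution map on `ℕ →ᵇ ℝ` are built INSIDE the proofs; node U2's `MemFlow` ∕
`picard` ∕ `memFlow_of_picard_eq` ∕ `picard_le_pin` ∕ `picard_sq_le`, (E37b)'s `le_picard_zm` ∕ `lower_le_upper_zm` ∕ `picard_contraction_zm`,
(E38a)'s `memFlow_unique_zs_closed` ∕ `le_inv_sqrt_of_le_inv_sq` and the tree's Schauder theorem
`Literature.Analysis.Convex.exists_fixedPoint_of_mapsTo_isCompact` BY NAME).  Companion of (E38a–c).

HONEST FRAMING (page 1, verbatim and binding).  *"Discharging BetaPertH makes Bałaban's UV stability UNCONDITIONAL — a real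
constructive-QFT result; it is NOT the continuum limit and NOT the Clay problem."*  THIS FILE DISCHARGES NOTHING OF THE KIND.  Pure real
analysis (a fixed-point argument) about an ABSTRACT functional with displayed zeroth moment and floor; nothing of Bałaban's (1.22) or its
limit functional is asserted; for the lattice families of the cell existence of the continuum coupling is (E33)'s business (rows-only) and
is not touched here.  Row D4 class UNCHANGED (critical-path width 0; instance 0∕1; D4 DISCHARGE NO DATE).  HONEST DEPENDENCY: continuum YM
on T⁴ ⇐ BetaPertH ∧ nine spine estimates (0/9 proved); BetaPertH ⇐ (D1) ∧ (D4) ∧ CAP+tail; G-an2-4 gates asym, D1 and NE2/3/4.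

THE POINT.  Node U2 ∕ (E37b) ∕ (E37h) ∕ (E38b) obtain existence from the Picard CONTRACTION, hence only under the smallness.  But the
solution map `T h (m) = (1∕gIR² + Σ_{l<m} B(h(l+1+·)))^{−1∕2}` maps the cube `C = {lo m ≤ h m ≤ hi m}`, `hi m = (1∕gIR² + m·b)^{−1∕2}`,
`lo m = (1∕gIR² + m·(B(γ,…) + M·γ))^{−1∕2}`, into itself (node U2's `picard_sq_le`, (E37b)'s `le_picard_zm`), is `M·γ∕b`-Lipschitz there in
the supremum distance ((E37b)'s `picard_contraction_zm` — ANY finite constant will do), and `C`, a product of intervals whose widths tend to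
`0`, is a COMPACT convex subset of the Banach space `ℕ →ᵇ ℝ` (the continuous image of a Tychonoff cube: on `C` the product topology and the
supremum norm agree because the tails are uniformly small — this is where the floor `b > 0`, i.e. asymptotic freedom, enters).  Schauder
(`exists_fixedPoint_of_mapsTo_isCompact`, the tree's [GilbargTrudinger2001, Cor. 11.2]) gives a fixed point, i.e. a box solution, for
EVERY `M`.  Hence the moment table's AUTONOMY row splits cleanly: EXISTENCE — zeroth moment finite, no size condition; UNIQUENESS —
`M·γ ≤ 3√3·b`, sharp ((E38a)∕(E38c)).  NOT claimed: existence for functionals without a uniform modulus on the box; anything printed.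

WHAT IS PROVED ([folklore]; 0 `def`, 0 sorry).  §1 `hi_tail_le` (the cube's widths: `(1∕gIR² + m·b)^{−1∕2} ≤ ε` beyond `1∕(b·ε²)`),
**`isCompact_cube`** (`{f : ℕ →ᵇ ℝ | lo m ≤ f m ≤ hi m}` is compact when `0 ≤ lo ≤ hi ≤ R` and `hi → 0`), `convex_cube`.  §2
**`exists_memFlow_zm`** (zeroth moment `M ≥ 0`, floor `b > 0`, pin `gIR ∈ ]0,γ]` ⟹ `∃ h, SeqBox γ h ∧ MemFlow B gIR h` — NO smallness),
`exists_memFlow_of_memoryProfile` (node U2's class: every `Cm ≥ 0`, `0 ≤ θ < 1`, NO `hsmall`), **`existsUnique_memFlow_zs_closed`**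
(`M·γ ≤ 3√3·b` ⟹ `∃! h, SeqBox γ h ∧ MemFlow B gIR h`), `exists_two_or_unique` (the dichotomy by the ratio, with (E38a)).
-/

noncomputable section
open Filter Topology Finset Set BoundedContinuousFunction

namespace Summit.QuantumFields.BalabanUV.Beta.EriceRemainderEnclosureHistoryAutonomyExistence

open Literature.MathematicalPhysics.QuantumFieldTheory.Balaban1983to89
open Literature.MathematicalPhysics.QuantumFieldTheory.Balaban1983to89.T4BetaStationary
open Literature.MathematicalPhysics.QuantumFieldTheory.Balaban1983to89.T4BetaFlowWellPosed
open Summit.QuantumFields.BalabanUV.Beta.EriceRemainderEnclosureHistoryAutonomyWellPosed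
open Summit.QuantumFields.BalabanUV.Beta.EriceRemainderEnclosureHistoryAutonomyThreshold

variable {B : (ℕ → ℝ) → ℝ} {M γ b gIR : ℝ}

/-! ## §1 The asymptotic-freedom cube is compact and convex in `ℕ →ᵇ ℝ` -/

/-- THE WIDTHS OF THE CUBE TEND TO ZERO: for `b > 0`, `ε > 0` there is `J` with `1∕√(1∕gIR² + m·b) ≤ ε` for all `m ≥ J`. [folklore] -/
theorem hi_tail_le (hb : 0 < b) {ε : ℝ} (hε : 0 < ε) :
    ∃ J : ℕ, ∀ m : ℕ, J ≤ m → 1 / Real.sqrt (1 / gIR ^ 2 + (m : ℝ) * b) ≤ ε := by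
  obtain ⟨J, hJ⟩ : ∃ J : ℕ, 1 / (b * ε ^ 2) < J := exists_nat_gt _
  refine ⟨J, fun m hm => ?_⟩
  have hmJ : 1 / (b * ε ^ 2) < (m : ℝ) := hJ.trans_le (by exact_mod_cast hm)
  have hP : 1 / ε ^ 2 < 1 / gIR ^ 2 + (m : ℝ) * b := by
    have h1 : 1 / ε ^ 2 < (m : ℝ) * b := by
      rw [div_lt_iff₀ (by positivity)] at hmJ
      rw [div_lt_iff₀ (by positivity)]
      linarith
    exact h1.trans_le (le_add_of_nonneg_left (by positivity))
  have hP0 : 0 < 1 / gIR ^ 2 + (m : ℝ) * b := lt_trans (by positivity) hP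
  rw [div_le_iff₀ (Real.sqrt_pos.2 hP0), ← div_le_iff₀' hε]
  calc 1 / ε = Real.sqrt (1 / ε ^ 2) := by rw [← one_div_pow, Real.sqrt_sq (by positivity)]
    _ ≤ Real.sqrt (1 / gIR ^ 2 + (m : ℝ) * b) := Real.sqrt_le_sqrt hP.le

/-- **THE CUBE IS COMPACT.**  For `0 ≤ lo m ≤ hi m ≤ R` with `hi m ≤ ε` beyond some `J(ε)` for every `ε > 0`, the set
`{f : ℕ →ᵇ ℝ | ∀ m, lo m ≤ f m ≤ hi m}` is compact in the supremum norm: it is the image of the Tychonoff cube `∏_m [lo m, hi m]` under the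
clamp `u ↦ (m ↦ max (min (u m) (hi m)) (lo m))`, which is continuous from the PRODUCT topology to the norm topology because beyond `J(ε∕2)`
any two points of the cube are `ε∕2`-close. [folklore] -/
theorem isCompact_cube {lo hi : ℕ → ℝ} {R : ℝ} (hlo : ∀ m, 0 ≤ lo m) (hlohi : ∀ m, lo m ≤ hi m) (hhiR : ∀ m, hi m ≤ R)
    (htail : ∀ ε : ℝ, 0 < ε → ∃ J : ℕ, ∀ m : ℕ, J ≤ m → hi m ≤ ε) :
    IsCompact {f : ℕ →ᵇ ℝ | ∀ m, lo m ≤ f m ∧ f m ≤ hi m} := by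
  have hcl : ∀ u : ℕ → ℝ, ∀ m, lo m ≤ max (min (u m) (hi m)) (lo m) ∧ max (min (u m) (hi m)) (lo m) ≤ hi m :=
    fun u m => ⟨le_max_right _ _, max_le (min_le_right _ _) (hlohi m)⟩
  have hbd : ∀ u : ℕ → ℝ, ∀ m, ‖max (min (u m) (hi m)) (lo m)‖ ≤ R := fun u m => by
    rw [Real.norm_eq_abs, abs_of_nonneg ((hlo m).trans (hcl u m).1)]
    exact (hcl u m).2.trans (hhiR m)
  set Ψ : (ℕ → ℝ) → (ℕ →ᵇ ℝ) := fun u =>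
    BoundedContinuousFunction.ofNormedAddCommGroupDiscrete (fun m => max (min (u m) (hi m)) (lo m)) R (hbd u) with hΨ
  have hΨapply : ∀ u m, Ψ u m = max (min (u m) (hi m)) (lo m) := fun u m => rfl
  -- continuity of the clamp from the product topology to the norm topology
  have hΨc : Continuous Ψ := by
    rw [continuous_iff_continuousAt]
    intro u₀
    rw [ContinuousAt, Metric.tendsto_nhds]
    intro ε hε
    obtain ⟨J, hJ⟩ := htail (ε / 2) (half_pos hε)
    have hev : ∀ᶠ u in 𝓝 u₀, ∀ m ∈ Finset.range J, dist (u m) (u₀ m) < ε / 2 := by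
      refine (Filter.eventually_all_finset _).2 fun m _ => ?_
      exact Metric.tendsto_nhds.1 ((continuous_apply m).tendsto u₀) (ε / 2) (half_pos hε)
    refine hev.mono fun u hu => ?_
    refine lt_of_le_of_lt ((BoundedContinuousFunction.dist_le (half_pos hε).le).2 fun m => ?_) (half_lt_self hε)
    rw [hΨapply, hΨapply, Real.dist_eq]
    by_cases hm : m < J
    · have h1 := hu m (Finset.mem_range.2 hm)
      rw [Real.dist_eq] at h1
      calc |max (min (u m) (hi m)) (lo m) - max (min (u₀ m) (hi m)) (lo m)|
          ≤ |min (u m) (hi m) - min (u₀ m) (hi m)| := abs_max_sub_max_le_abs _ _ _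
        _ ≤ max |u m - u₀ m| |hi m - hi m| := abs_min_sub_min_le_max _ _ _ _
        _ = |u m - u₀ m| := by rw [sub_self, abs_zero, max_eq_left (abs_nonneg _)]
        _ ≤ ε / 2 := h1.le
    · have hmJ : J ≤ m := not_lt.1 hm
      have hA := hcl u m
      have hA₀ := hcl u₀ m
      calc |max (min (u m) (hi m)) (lo m) - max (min (u₀ m) (hi m)) (lo m)| ≤ hi m :=
            abs_sub_le_of_nonneg_of_le ((hlo m).trans hA.1) hA.2 ((hlo m).trans hA₀.1) hA₀.2
        _ ≤ ε / 2 := hJ m hmJ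
  -- the cube is the image of the Tychonoff cube
  have hP : IsCompact (Set.pi Set.univ fun m : ℕ => Set.Icc (lo m) (hi m)) := isCompact_univ_pi fun m => isCompact_Icc
  have heq : {f : ℕ →ᵇ ℝ | ∀ m, lo m ≤ f m ∧ f m ≤ hi m} = Ψ '' (Set.pi Set.univ fun m : ℕ => Set.Icc (lo m) (hi m)) := by
    ext f
    constructor
    · intro hf
      refine ⟨⇑f, fun m _ => ⟨(hf m).1, (hf m).2⟩, ?_⟩
      ext m
      rw [hΨapply, min_eq_left (hf m).2, max_eq_left (hf m).1]
    · rintro ⟨u, -, rfl⟩ m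
      exact hcl u m
  rw [heq]
  exact hP.image hΨc

/-- THE CUBE IS CONVEX. [folklore] -/
theorem convex_cube (lo hi : ℕ → ℝ) : Convex ℝ {f : ℕ →ᵇ ℝ | ∀ m, lo m ≤ f m ∧ f m ≤ hi m} := by
  intro f hf g hg a c ha hc hac m
  have e : (a • f + c • g) m = a * f m + c * g m := by simp [smul_eq_mul]
  rw [e]
  have hf' : lo m ≤ f m ∧ f m ≤ hi m := hf m
  have hg' : lo m ≤ g m ∧ g m ≤ hi m := hg m
  have e1 : lo m = a * lo m + c * lo m := by rw [← add_mul, hac, one_mul]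
  have e2 : hi m = a * hi m + c * hi m := by rw [← add_mul, hac, one_mul]
  constructor
  · linarith [mul_le_mul_of_nonneg_left hf'.1 ha, mul_le_mul_of_nonneg_left hg'.1 hc]
  · linarith [mul_le_mul_of_nonneg_left hf'.2 ha, mul_le_mul_of_nonneg_left hg'.2 hc]

/-! ## §2 Existence of a box solution for every zeroth-moment functional with floor, every pin -/

/-- **EXISTENCE WITHOUT SMALLNESS.**  `B` with zeroth moment `M ≥ 0` (`|B u − B u′| ≤ M·D` for entrywise `D`-close box histories) and
floor `b > 0` on the box ]0,γ]^ℕ, pin `gIR ∈ ]0,γ]`: there IS a box solution of the flow with memory from `gIR` — for EVERY `M`.  Schauder's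
fixed point theorem for node U2's solution map on the compact convex asymptotic-freedom cube of `ℕ →ᵇ ℝ`. [folklore] -/
theorem exists_memFlow_zm
    (hB : ∀ u u' : ℕ → ℝ, SeqBox γ u → SeqBox γ u' → ∀ D : ℝ, (∀ j, |u j - u' j| ≤ D) → |B u - B u'| ≤ M * D)
    (hM : 0 ≤ M) (hgIR : 0 < gIR) (hgIRγ : gIR ≤ γ) (hb : 0 < b) (hlo : ∀ u, SeqBox γ u → b ≤ B u) :
    ∃ h : ℕ → ℝ, SeqBox γ h ∧ MemFlow B gIR h := by
  have hγ : 0 < γ := lt_of_lt_of_le hgIR hgIRγ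
  -- the envelope of the cube
  set U : ℝ := B (fun _ => γ) + M * γ with hU
  have hbU : b ≤ U := lower_le_upper_zm hM hγ hlo
  have hU0 : 0 < U := hb.trans_le hbU
  set lo : ℕ → ℝ := fun m => 1 / Real.sqrt (1 / gIR ^ 2 + (m : ℝ) * U) with hlo_def
  set hi : ℕ → ℝ := fun m => 1 / Real.sqrt (1 / gIR ^ 2 + (m : ℝ) * b) with hhi_def
  have hbase : ∀ m : ℕ, 0 < 1 / gIR ^ 2 + (m : ℝ) * b := fun m => by positivity
  have hbaseU : ∀ m : ℕ, 0 < 1 / gIR ^ 2 + (m : ℝ) * U := fun m => by positivity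
  have hlo0 : ∀ m, 0 < lo m := fun m => one_div_pos.2 (Real.sqrt_pos.2 (hbaseU m))
  have hlohi : ∀ m, lo m ≤ hi m := fun m =>
    one_div_sqrt_anti (hbase m) (add_le_add le_rfl (mul_le_mul_of_nonneg_left hbU (Nat.cast_nonneg m)))
  have hhipin : ∀ m, hi m ≤ gIR := fun m =>
    one_div_sqrt_le hgIR (le_add_of_nonneg_right (mul_nonneg (Nat.cast_nonneg m) hb.le))
  have hhiγ : ∀ m, hi m ≤ γ := fun m => (hhipin m).trans hgIRγ
  -- the cube
  set C : Set (ℕ →ᵇ ℝ) := {f | ∀ m, lo m ≤ f m ∧ f m ≤ hi m} with hC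
  have hCc : IsCompact C :=
    isCompact_cube (fun m => (hlo0 m).le) hlohi hhiγ fun ε hε => hi_tail_le (gIR := gIR) hb hε
  have hCconv : Convex ℝ C := convex_cube lo hi
  have hCcl : IsClosed C := hCc.isClosed
  have hbox : ∀ f : ℕ →ᵇ ℝ, f ∈ C → SeqBox γ ⇑f := fun f hf m => ⟨(hlo0 m).trans_le (hf m).1, (hf m).2.trans (hhiγ m)⟩
  -- an element: the upper envelope itself
  have hhi_bd : ∀ m, ‖hi m‖ ≤ γ := fun m => by
    rw [Real.norm_eq_abs, abs_of_pos ((hlo0 m).trans_le (hlohi m))]; exact hhiγ m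
  have hne : C.Nonempty := ⟨BoundedContinuousFunction.ofNormedAddCommGroupDiscrete hi γ hhi_bd, fun m => ⟨hlohi m, le_rfl⟩⟩
  -- the clamp and the solution map on `ℕ →ᵇ ℝ`
  have hcl : ∀ f : ℕ →ᵇ ℝ, SeqBox γ (fun j => max (min (f j) (hi j)) (lo j)) := fun f j =>
    ⟨(hlo0 j).trans_le (le_max_right _ _), (max_le (min_le_right _ _) (hlohi j)).trans (hhiγ j)⟩
  have hcl_eq : ∀ f : ℕ →ᵇ ℝ, f ∈ C → (fun j => max (min (f j) (hi j)) (lo j)) = ⇑f := fun f hf => by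
    funext j; rw [min_eq_left (hf j).2, max_eq_left (hf j).1]
  have hpic_bd : ∀ f : ℕ →ᵇ ℝ, ∀ m, ‖picard B gIR (fun j => max (min (f j) (hi j)) (lo j)) m‖ ≤ γ := fun f m => by
    rw [Real.norm_eq_abs, abs_of_pos (picard_pos hgIR hb hlo (hcl f) m)]
    exact (picard_le_pin hgIR hb hlo (hcl f) m).trans hgIRγ
  set Φ : (ℕ →ᵇ ℝ) → (ℕ →ᵇ ℝ) := fun f =>
    BoundedContinuousFunction.ofNormedAddCommGroupDiscrete
      (fun m => picard B gIR (fun j => max (min (f j) (hi j)) (lo j)) m) γ (hpic_bd f) with hΦ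
  have hΦapply : ∀ f m, Φ f m = picard B gIR (fun j => max (min (f j) (hi j)) (lo j)) m := fun f m => rfl
  have hΦC : ∀ f, f ∈ C → ∀ m, Φ f m = picard B gIR ⇑f m := fun f hf m => by rw [hΦapply, hcl_eq f hf]
  -- the solution map preserves the cube
  have hmaps : MapsTo Φ C C := by
    intro f hf m
    rw [hΦC f hf m]
    refine ⟨le_picard_zm hB hγ hgIR hb hlo (hbox f hf) m, ?_⟩
    have h2 := picard_sq_le hgIR hb hlo (hbox f hf) m
    have h3 : 1 / gIR ^ 2 + (m : ℝ) * b ≤ 1 / picard B gIR (⇑f) m ^ 2 := by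
      have := one_div_le_one_div_of_le (by have := picard_pos hgIR hb hlo (hbox f hf) m; positivity) h2
      rwa [one_div_one_div] at this
    exact le_inv_sqrt_of_le_inv_sq (picard_pos hgIR hb hlo (hbox f hf) m) (hbase m) h3
  -- the solution map is Lipschitz on the cube, hence continuous
  have hΦcont : ContinuousOn Φ C := by
    rw [Metric.continuousOn_iff]
    intro f hf ε hε
    refine ⟨ε / (M * γ / b + 1), div_pos hε (by positivity), fun g hg hfg => ?_⟩
    have hq0 : 0 ≤ M * γ / b := by positivity
    have hD : ∀ i, |g i - f i| ≤ dist g f := fun i => by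
      rw [← Real.dist_eq]; exact BoundedContinuousFunction.dist_coe_le_dist i
    have hle : dist (Φ g) (Φ f) ≤ M * γ / b * dist g f := by
      refine (BoundedContinuousFunction.dist_le (mul_nonneg hq0 dist_nonneg)).2 fun m => ?_
      rw [hΦC g hg m, hΦC f hf m, Real.dist_eq]
      exact picard_contraction_zm hB hM hgIR hgIRγ hb hlo (hbox g hg) (hbox f hf) hD m
    calc dist (Φ g) (Φ f) ≤ M * γ / b * dist g f := hle
      _ < M * γ / b * (ε / (M * γ / b + 1)) + 1 * (ε / (M * γ / b + 1)) := by
          nlinarith [mul_le_mul_of_nonneg_left hfg.le hq0, div_pos hε (by positivity : (0:ℝ) < M * γ / b + 1)]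
      _ = ε := by field_simp
  -- Schauder
  obtain ⟨f, hfC, hfix⟩ :=
    Literature.Analysis.Convex.exists_fixedPoint_of_mapsTo_isCompact hCconv hCcl hne hCc hΦcont hmaps hmaps
  refine ⟨⇑f, hbox f hfC, memFlow_of_picard_eq hgIR hb hlo (hbox f hfC) ?_⟩
  funext m
  rw [← hΦC f hfC m, hfix]

/-- Node U2's class: `MemoryProfile Cm θ γ B` (`Cm ≥ 0`, `0 ≤ θ < 1`) with floor `b > 0` — a box solution EXISTS from every pin, with NO
`hsmall` (node U2's `existsUnique_memFlow` needs `Cm·γ < b(1−θ)` — for the uniqueness half only). [folklore] -/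
theorem exists_memFlow_of_memoryProfile {Cm θ : ℝ} (hBp : MemoryProfile Cm θ γ B) (hCm : 0 ≤ Cm) (hθ0 : 0 ≤ θ) (hθ1 : θ < 1)
    (hgIR : 0 < gIR) (hgIRγ : gIR ≤ γ) (hb : 0 < b) (hlo : ∀ u, SeqBox γ u → b ≤ B u) :
    ∃ h : ℕ → ℝ, SeqBox γ h ∧ MemFlow B gIR h :=
  exists_memFlow_zm (zerothMoment_of_memoryProfile hBp hCm hθ0 hθ1) (div_nonneg hCm (by linarith)) hgIR hgIRγ hb hlo

/-- **WELL-POSEDNESS UNDER THE CLOSED CONDITION `M·γ ≤ 3√3·b`**: exactly one box solution per pin — existence by Schauder (this file),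
uniqueness by (E38a)'s `memFlow_unique_zs_closed`; (E38b)'s `existsUnique_memFlow_zs` had the open condition. [folklore] -/
theorem existsUnique_memFlow_zs_closed
    (hB : ∀ u u' : ℕ → ℝ, SeqBox γ u → SeqBox γ u' → ∀ D : ℝ, (∀ j, |u j - u' j| ≤ D) → |B u - B u'| ≤ M * D)
    (hM : 0 ≤ M) (hgIR : 0 < gIR) (hgIRγ : gIR ≤ γ) (hb : 0 < b) (hlo : ∀ u, SeqBox γ u → b ≤ B u)
    (hsmall : M * γ ≤ 3 * Real.sqrt 3 * b) : ∃! h : ℕ → ℝ, SeqBox γ h ∧ MemFlow B gIR h := by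
  obtain ⟨h, hh, hf⟩ := exists_memFlow_zm hB hM hgIR hgIRγ hb hlo
  exact ⟨h, ⟨hh, hf⟩, fun h' hh' => memFlow_unique_zs_closed hB hM hgIR hgIRγ hb hlo hsmall hh'.1 hh hh'.2 hf⟩

/-- **THE DICHOTOMY OF THE AUTONOMY ROW BY THE RATIO.**  For every zeroth-moment functional with floor and every pin there is a box
solution; if `M·γ ≤ 3√3·b` it is the only one — while for every ratio above `3√3` (E38c) exhibits functionals with two. [folklore] -/
theorem exists_and_unique_of_ratio_le
    (hB : ∀ u u' : ℕ → ℝ, SeqBox γ u → SeqBox γ u' → ∀ D : ℝ, (∀ j, |u j - u' j| ≤ D) → |B u - B u'| ≤ M * D)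
    (hM : 0 ≤ M) (hgIR : 0 < gIR) (hgIRγ : gIR ≤ γ) (hb : 0 < b) (hlo : ∀ u, SeqBox γ u → b ≤ B u) :
    (∃ h : ℕ → ℝ, SeqBox γ h ∧ MemFlow B gIR h) ∧
      (M * γ ≤ 3 * Real.sqrt 3 * b → ∀ h h' : ℕ → ℝ, SeqBox γ h → SeqBox γ h' → MemFlow B gIR h → MemFlow B gIR h' → h = h') :=
  ⟨exists_memFlow_zm hB hM hgIR hgIRγ hb hlo,
    fun hsmall _ _ hh hh' hf hf' => memFlow_unique_zs_closed hB hM hgIR hgIRγ hb hlo hsmall hh hh' hf hf'⟩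

end Summit.QuantumFields.BalabanUV.Beta.EriceRemainderEnclosureHistoryAutonomyExistence

end
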